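import Summits.ResolutionOfSingularities.ResolutionOfSingularities.Theses.WeightedInvariant
import Literature.AlgebraicGeometry.Resolution.RegularLocalRingsNormal
import Literature.AlgebraicGeometry.Motives.VarietiesProjectiveSpaceProofs

/-!
# `DatumToEmbedded` — negative lemmas III: the strengthening "`X` is itself regular" fails

Support (negative) lemma for crux `stmt-ResolutionOfSingularities-0572` (`DatumToEmbedded`), filed by
the standing disprover (cdisprove gen 1, cycle 1; work file `Cruxes/DatumToEmbedded/Disproof.lean`).

`datumToEmbedded_strengthening_isRegular_false`: at every prime, NOT every integral closed subscheme
of a smooth separated quasi-compact scheme over a perfect field of characteristic `p` is regular —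
witness the cuspidal cubic `Spec 𝔽_p[T², T³] ↪ 𝔸²_{𝔽_p}` (`exists_isClosedImmersion_cusp`:
`x ↦ T²`, `y ↦ T³` is onto the cusp algebra; `𝔸² → Spec 𝔽_p` smooth from the tree's
`isStandardSmoothOfRelativeDimension_mvPolynomial_fin`). So the conclusion `HasResolution X` of the
crux is not witnessed by `𝟙 X` in general: the crux has content at every prime in dimension one.
The non-regularity of the cusp (`cusp_*`, `not_isRegular_spec_cusp`: `T = T³/T²` is integral and
not in `𝔽_p[T², T³]`, a regular local ring is integrally closed — Matsumura 19.4 =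
`isIntegrallyClosed_of_isRegularLocalRing` in tree — and integral closedness is local) is the
argument of the sibling file `Theorems/WeightedThesis/Negative/LoadBearing.lean`, re-proved under
this namespace because that module was not importable on the check farm when this was written.

## Sources
* H. Matsumura, *Commutative Ring Theory*, CUP 1986, Thm. 19.4 (regular local ⇒ normal; in tree).
* R. Hartshorne, *Algebraic Geometry*, III §10 Example 10.0.1 (`𝔸ⁿ` smooth).
-/

noncomputable section

open CategoryTheory AlgebraicGeometry TopologicalSpace
open Literature.AlgebraicGeometry.Resolution
open Summit.ResolutionOfSingularities.ResolutionOfSingularities.Theses.WeightedInvariant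

set_option linter.dupNamespace false

namespace Summit.ResolutionOfSingularities.ResolutionOfSingularities.Theorems.DatumToEmbedded.Negative

section Cusp

open Polynomial

variable (K : Type) [Field K]

/-- Elements of the cusp algebra `K[T², T³] = Algebra.adjoin K {T², T³} ⊆ K[T]` have no linear
term. (Same proof as in the sibling file `Theorems/WeightedThesis/Negative/LoadBearing.lean`,
`cusp_coeff_one_eq_zero`, under this namespace.) [folklore] -/
theorem cusp_coeff_one_eq_zero {s : K[X]}
    (hs : s ∈ Algebra.adjoin K ({X ^ 2, X ^ 3} : Set K[X])) : s.coeff 1 = 0 := by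
  refine Algebra.adjoin_induction (p := fun s _ => s.coeff 1 = 0) ?_ ?_ ?_ ?_ hs
  · intro x hx
    simp only [Set.mem_insert_iff, Set.mem_singleton_iff] at hx
    rcases hx with hx | hx <;> rw [hx, Polynomial.coeff_X_pow] <;> simp
  · intro r
    show (algebraMap K K[X] r).coeff 1 = 0
    rw [Polynomial.algebraMap_apply, Polynomial.coeff_C]
    simp
  · intro x y _ _ hx hy
    simp [hx, hy]
  · intro x y _ _ hx hy
    simp [Polynomial.coeff_mul, Finset.Nat.sum_antidiagonal_succ, hx, hy]

/-- `T ∉ K[T², T³]`. [folklore] -/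
theorem cusp_X_not_mem : (X : K[X]) ∉ Algebra.adjoin K ({X ^ 2, X ^ 3} : Set K[X]) := fun h => by
  simpa using cusp_coeff_one_eq_zero K h

/-- `K[T², T³]` is not integrally closed: `T = T³/T²` is integral over it but not in it.
(Sibling's `cusp_not_isIntegrallyClosed`, copied.) [folklore] -/
theorem cusp_not_isIntegrallyClosed :
    ¬ IsIntegrallyClosed ↥(Algebra.adjoin K ({X ^ 2, X ^ 3} : Set K[X])) := by
  intro h
  set A : Subalgebra K K[X] := Algebra.adjoin K ({X ^ 2, X ^ 3} : Set K[X]) with hA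
  have h2 : (X ^ 2 : K[X]) ∈ A := Algebra.subset_adjoin (by simp)
  have h3 : (X ^ 3 : K[X]) ∈ A := Algebra.subset_adjoin (by simp)
  let a2 : A := ⟨X ^ 2, h2⟩
  let a3 : A := ⟨X ^ 3, h3⟩
  have ha2 : a2 ≠ 0 := by
    intro h0
    have := congrArg Subtype.val h0
    simp [a2] at this
  let L := FractionRing A
  have ha2L : algebraMap A L a2 ≠ 0 := fun h0 =>
    ha2 ((IsFractionRing.injective A L) (h0.trans (map_zero _).symm))
  let x : L := algebraMap A L a3 / algebraMap A L a2
  have hx2 : x ^ 2 = algebraMap A L a2 := by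
    rw [div_pow, div_eq_iff (pow_ne_zero 2 ha2L), ← map_pow, ← map_pow, ← map_mul]
    congr 1
    apply Subtype.ext
    simp [a2, a3]
    ring
  obtain ⟨y, hy⟩ := IsIntegrallyClosed.exists_algebraMap_eq_of_isIntegral_pow (R := A) (K := L)
    two_pos (hx2 ▸ isIntegral_algebraMap)
  have hy' : algebraMap A L (y * a2) = algebraMap A L a3 := by
    rw [map_mul, hy, div_mul_cancel₀ _ ha2L]
  have hy'' : y * a2 = a3 := IsFractionRing.injective A L hy'
  have hval : (y : K[X]) * X ^ 2 = X ^ 3 := by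
    have := congrArg Subtype.val hy''
    simpa [a2, a3] using this
  have hyX : (y : K[X]) = X := by
    have hX2 : (X ^ 2 : K[X]) ≠ 0 := pow_ne_zero 2 X_ne_zero
    apply mul_right_cancel₀ hX2
    rw [hval]; ring
  have hXA : (X : K[X]) ∈ A := by rw [← hyX]; exact y.2
  exact cusp_X_not_mem K hXA

/-- Some maximal ideal of `K[T², T³]` has a non-regular local ring (else every localisation at a
maximal ideal is integrally closed by Matsumura 19.4 = `isIntegrallyClosed_of_isRegularLocalRing`,
hence so is `K[T², T³]`). (Sibling's lemma, copied.) [cite: Matsumura1987, Thm. 19.4] -/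
theorem cusp_exists_not_isRegularLocalRing :
    ∃ (m : Ideal ↥(Algebra.adjoin K ({X ^ 2, X ^ 3} : Set K[X]))) (_ : m.IsMaximal),
      ¬ IsRegularLocalRing (Localization.AtPrime m) := by
  by_contra hall
  simp only [not_exists, not_not] at hall
  refine cusp_not_isIntegrallyClosed K
    (IsIntegrallyClosed.of_localization_maximal fun m _ hm => ?_)
  haveI := hall m hm
  exact isIntegrallyClosed_of_isRegularLocalRing _

/-- **The cuspidal cubic `Spec K[T², T³]` is not regular.** (Sibling's lemma, copied.) [folklore] -/
theorem not_isRegular_spec_cusp :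
    ¬ Scheme.IsRegular (Spec (.of ↥(Algebra.adjoin K ({X ^ 2, X ^ 3} : Set K[X])))) := by
  intro h
  obtain ⟨m, hm, hreg⟩ := cusp_exists_not_isRegularLocalRing K
  let x : PrimeSpectrum ↥(Algebra.adjoin K ({X ^ 2, X ^ 3} : Set K[X])) := ⟨m, hm.isPrime⟩
  haveI := h x
  exact hreg (IsRegularLocalRing.of_ringEquiv
    (Spec.stalkIso (.of ↥(Algebra.adjoin K ({X ^ 2, X ^ 3} : Set K[X]))) x).commRingCatIsoToRingEquiv)

/-- The generators `T², T³` as a `Fin 2`-family: its range is `{T², T³}`. [folklore] -/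
theorem range_cuspGen :
    Set.range (fun j : Fin 2 => (X : K[X]) ^ ((j : ℕ) + 2)) = ({X ^ 2, X ^ 3} : Set K[X]) := by
  ext x
  simp only [Set.mem_range, Set.mem_insert_iff, Set.mem_singleton_iff, Fin.exists_fin_two]
  simp only [Fin.val_zero, Fin.val_one]
  constructor
  · rintro (h | h) <;> [left; right] <;> exact h.symm
  · rintro (h | h) <;> [left; right] <;> exact h.symm

/-- The cusp algebra is the range of `K[x, y] → K[T]`, `x ↦ T²`, `y ↦ T³`. [folklore] -/
theorem cusp_eq_range :
    Algebra.adjoin K ({X ^ 2, X ^ 3} : Set K[X]) =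
      (MvPolynomial.aeval fun j : Fin 2 => (X : K[X]) ^ ((j : ℕ) + 2)).range := by
  rw [← range_cuspGen, Algebra.adjoin_range_eq_range_aeval]

/-- **The cusp is a closed subscheme of the plane**: `K[x, y] → K[T², T³]`, `x ↦ T²`, `y ↦ T³`,
is surjective onto the cusp algebra, so its `Spec` is a closed immersion
`Spec K[T², T³] ↪ 𝔸²_K`. [folklore] -/
theorem exists_isClosedImmersion_cusp :
    ∃ i : Spec (.of ↥(Algebra.adjoin K ({X ^ 2, X ^ 3} : Set K[X]))) ⟶
      Spec (.of (MvPolynomial (Fin 2) K)), IsClosedImmersion i := by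
  let e := Subalgebra.equivOfEq _ _ (cusp_eq_range K).symm
  let ψ : MvPolynomial (Fin 2) K →ₐ[K] ↥(Algebra.adjoin K ({X ^ 2, X ^ 3} : Set K[X])) :=
    e.toAlgHom.comp (MvPolynomial.aeval fun j : Fin 2 => (X : K[X]) ^ ((j : ℕ) + 2)).rangeRestrict
  have hψ : Function.Surjective ψ := e.surjective.comp (AlgHom.rangeRestrict_surjective _)
  exact ⟨Spec.map (CommRingCat.ofHom ψ.toRingHom), IsClosedImmersion.spec_of_surjective _ hψ⟩

/-- **Strengthening "`X` is itself regular" refuted at every prime, already for plane curves**: the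
cusp `Spec 𝔽_p[T², T³] ↪ 𝔸²_{𝔽_p}` is an integral closed subscheme of a smooth separated
quasi-compact `𝔽_p`-scheme and is not regular. So `HasResolution X` is not witnessed by `𝟙 X` in
general: the crux has content at every prime in dimension one. [folklore] -/
theorem datumToEmbedded_strengthening_isRegular_false (p : ℕ) [Fact p.Prime] :
    ¬ ∀ (k : Type) [Field k] [CharP k p] [PerfectField k] (Y X : Scheme.{0})
        (f : Y ⟶ Spec (.of k)) (i : X ⟶ Y), Smooth f → IsSeparated f → QuasiCompact f →
          IsClosedImmersion i → IsIntegral X → Scheme.IsRegular X := by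
  intro h
  let f : Spec (.of (MvPolynomial (Fin 2) (ZMod p))) ⟶ Spec (.of (ZMod p)) :=
    Spec.map (CommRingCat.ofHom (algebraMap (ZMod p) (MvPolynomial (Fin 2) (ZMod p))))
  obtain ⟨i, hi⟩ := exists_isClosedImmersion_cusp (ZMod p)
  haveI : Smooth f := by
    haveI : SmoothOfRelativeDimension 2 f := by
      rw [HasRingHomProperty.Spec_iff (P := @SmoothOfRelativeDimension 2)]
      exact RingHom.locally_of RingHom.isStandardSmoothOfRelativeDimension_respectsIso _
        ((RingHom.isStandardSmoothOfRelativeDimension_algebraMap 2).mpr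
          (Literature.AlgebraicGeometry.Motives.ProjectiveSpace.isStandardSmoothOfRelativeDimension_mvPolynomial_fin
            (ZMod p) 2))
    exact SmoothOfRelativeDimension.smooth 2 _
  exact not_isRegular_spec_cusp (ZMod p)
    (h (ZMod p) _ _ f i inferInstance inferInstance inferInstance hi inferInstance)

end Cusp

end Summit.ResolutionOfSingularities.ResolutionOfSingularities.Theorems.DatumToEmbedded.Negative

end
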